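import Literature.AlgebraicGeometry.Ramification.KatoCleanInvariance
import Literature.AlgebraicGeometry.Resolution.RsopMonomialIdeals
import Literature.AlgebraicGeometry.Resolution.StrictNormalCrossings
import Mathlib.AlgebraicGeometry.AffineScheme
import HarnessLib

/-!
# Kato-cleanliness at a point of a strict normal crossings divisor does not depend on the local
# coordinates (Kato 1994 (3.4.3))

Topic: `Literature/AlgebraicGeometry/Ramification`. Companion to `KatoCleanRamification.lean`
(definition request `defn-KatoCleanRamification`): `Scheme.IsKatoCleanAt X p D f x` was defined
with an EXISTENTIAL quantifier over local snc coordinates `(z₁,…,z_r; y₁,…,y_e)` at `x` (the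
local clause of `IsStrictNormalCrossingsDivisor`). Using the invariance of the local predicate
under units (`KatoCleanInvariance.lean`) and permutations (this file, §Reindexing) and unique
factorisation into the prime
elements `zᵢ` of the regular local ring `𝒪_{X,x}` (`IsRsopPart`, `RsopMonomialIdeals.lean`), we
PROVE that the existential may be replaced by a universal quantifier: for a strict normal crossings
divisor `D` and `x ∈ D`, the Artin–Schreier class of `f` is Kato-clean at `x` iff it is clean in
EVERY system of local snc coordinates at `x` (`Scheme.isKatoCleanAt_iff_forall`). So the tree's
notion is attached to `(X, D, f, x)` alone, as Kato's is.

## Results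

* `LogDifferential.reindexEquiv`, `rswForm_reindex`, `isCleanAt_reindex_iff` — invariance of the
  local predicate under a permutation `σ` of the branches (`IsCleanAt p (z ∘ σ) f ↔ IsCleanAt p z f`);
* `exists_equiv_units_of_isRsopPart` — two parts `z : Fin r → A`, `z' : Fin r' → A` of regular
  systems of parameters with `(∏ zᵢ) = (∏ z'ⱼ)` match: `z'ⱼ = vⱼ · z_{e j}` for a bijection `e`
  and units `vⱼ`;
* `isCleanAt_iff_of_isRsopPart` — hence `IsCleanAt p z' f ↔ IsCleanAt p z f`;
* `Scheme.isKatoCleanAt_iff_forall` — the scheme-level statement above.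

## Sources

* K. Kato, Amer. J. Math. 116 (1994), (3.4.3). [Kato1994Ramification]
* Y. Yatagawa, arXiv:2206.02989 (2022), Def. 1.29, Lemma 1.15. [Yatagawa2022]
* H. Matsumura, *Commutative Ring Theory*, Thm. 14.3, 20.3 (regular local rings: primes `zᵢ`,
  UFD). [Matsumura1987]
-/

noncomputable section

namespace Literature.AlgebraicGeometry.Ramification

universe u v

open IsLocalRing Literature.AlgebraicGeometry.Resolution

/-! ## Reindexing the branches -/

section Reindex

variable {A : Type u} [CommRing A] {n : ℕ} (σ : Equiv.Perm (Fin n)) (z : Fin n → A)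

/-- The monomial is invariant under reindexing. [folklore] -/
theorem monomial_reindex (R : Fin n → ℕ) : monomial (z ∘ σ) (R ∘ σ) = monomial z R :=
  Equiv.prod_comp σ (fun i => z i ^ R i)

variable {K : Type v} [Field K] [Algebra A K] (p : ℕ) (f : K)

/-- The conductor vector is reindexed along with the branches. [folklore] -/
theorem conductorVector_reindex : conductorVector p (z ∘ σ) f = conductorVector p z f ∘ σ :=
  rfl

variable {p f}

/-- Normal forms do not depend on the order of the branches. [folklore] -/
theorem isNormalForm_reindex_iff (u : A) : IsNormalForm p (z ∘ σ) f u ↔ IsNormalForm p z f u := by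
  simp only [isNormalForm_iff, conductorVector_reindex, monomial_reindex]

namespace LogDifferential

/-- Transporting a basis vector: `eᵢ ∘ σ⁻¹ = e_{σ i}`. [folklore] -/
theorem single_comp_symm (i : Fin n) (a : A) :
    (fun j => (Pi.single i a : Fin n → A) (σ.symm j)) = Pi.single (σ i) a := by
  funext j
  simp only [Pi.single_apply, Equiv.symm_apply_eq]

variable (A) in
/-- Reindexing the presentation: `(ω, c) ↦ (ω, c ∘ σ⁻¹)`. [folklore] -/
def reindexAux : (Ω[A⁄ℤ] × (Fin n → A)) ≃ₗ[A] (Ω[A⁄ℤ] × (Fin n → A)) :=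
  LinearEquiv.prodCongr (LinearEquiv.refl A _) (LinearEquiv.funCongrLeft A A σ.symm)

/-- Unfolding lemma. [folklore] -/
theorem reindexAux_apply (ω : Ω[A⁄ℤ]) (c : Fin n → A) :
    reindexAux A σ (ω, c) = (ω, fun j => c (σ.symm j)) :=
  rfl

/-- The relations for `z ∘ σ` are carried onto the relations for `z`. [folklore] -/
theorem map_logRelations_reindexAux :
    (logRelations A (z ∘ σ)).map (reindexAux A σ : (Ω[A⁄ℤ] × (Fin n → A)) →ₗ[A] _) =
      logRelations A z := by
  rw [logRelations, logRelations, Submodule.map_span, ← Set.range_comp]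
  have e : ((reindexAux A σ : (Ω[A⁄ℤ] × (Fin n → A)) →ₗ[A] _) ∘
      (fun i : Fin n => (KaehlerDifferential.D ℤ A ((z ∘ σ) i), -Pi.single i ((z ∘ σ) i)))) =
        (fun i : Fin n => (KaehlerDifferential.D ℤ A (z i), -Pi.single i (z i))) ∘ σ := by
    funext i
    simp only [Function.comp_apply, LinearEquiv.coe_coe, reindexAux_apply]
    refine Prod.ext rfl ?_
    change -(fun j => (Pi.single i (z (σ i)) : Fin n → A) (σ.symm j)) = -Pi.single (σ i) (z (σ i))
    rw [single_comp_symm]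
  rw [e, σ.surjective.range_comp]

/-- **The comparison isomorphism** `Ω¹_A(log; z ∘ σ) ≃ Ω¹_A(log; z)`: identity on `Ω¹_A`,
`dlog (z ∘ σ)ᵢ ↦ dlog z_{σ i}`. [folklore] -/
def reindexEquiv : LogDifferential A (z ∘ σ) ≃ₗ[A] LogDifferential A z :=
  Submodule.Quotient.equiv _ _ (reindexAux A σ) (map_logRelations_reindexAux σ z)

/-- The comparison on representatives. [folklore] -/
theorem reindexEquiv_mk (x : Ω[A⁄ℤ] × (Fin n → A)) :
    reindexEquiv σ z (mk A (z ∘ σ) x) = mk A z (reindexAux A σ x) :=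
  rfl

/-- `dlog (z ∘ σ)ᵢ ↦ dlog z_{σ i}`. [folklore] -/
theorem reindexEquiv_dlog (i : Fin n) : reindexEquiv σ z (dlog A (z ∘ σ) i) = dlog A z (σ i) := by
  rw [dlog_def, reindexEquiv_mk, reindexAux_apply, dlog_def, single_comp_symm]

/-- The comparison is the identity on `Ω¹_A`. [folklore] -/
theorem reindexEquiv_ofKaehler (ω : Ω[A⁄ℤ]) :
    reindexEquiv σ z (ofKaehler A (z ∘ σ) ω) = ofKaehler A z ω :=
  rfl

end LogDifferential

/-- **The refined Swan conductor forms correspond** under reindexing. [folklore] -/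
theorem rswForm_reindex (R : Fin n → ℕ) (u : A) :
    LogDifferential.reindexEquiv σ z (rswForm (z ∘ σ) (R ∘ σ) u) = rswForm z R u := by
  rw [rswForm_eq_mk, rswForm_eq_mk, LogDifferential.reindexEquiv_mk,
    LogDifferential.reindexAux_apply]
  simp only [Function.comp_apply, Equiv.apply_symm_apply]

/-- **Kato-cleanliness does not depend on the order of the branches**:
`IsCleanAt p (z ∘ σ) f ↔ IsCleanAt p z f`. [cite: Kato1994Ramification, (3.4.3)] -/
theorem isCleanAt_reindex_iff [IsLocalRing A] : IsCleanAt p (z ∘ σ) f ↔ IsCleanAt p z f := by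
  rw [isCleanAt_iff, isCleanAt_iff, conductorVector_reindex]
  refine or_congr ⟨fun h i => ?_, fun h i => h (σ i)⟩ (exists_congr fun u => and_congr
    (isNormalForm_reindex_iff σ z u) (not_congr ?_))
  · simpa using h (σ.symm i)
  · rw [← mem_smul_top_iff_of_linearEquiv (LogDifferential.reindexEquiv σ z) (maximalIdeal A),
      rswForm_reindex]

end Reindex

/-! ## Matching two systems of local equations -/

section Matching

variable {A : Type u} [CommRing A] [IsLocalRing A]

/-- **Two systems of local snc equations of the same divisor germ differ by order and units.** If
`z : Fin r → A` and `z' : Fin r' → A` are parts of regular systems of parameters of the (regular)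
local ring `A` with `(∏ zᵢ) = (∏ z'ⱼ)`, then `z'ⱼ = vⱼ z_{e j}` for a bijection `e : Fin r' ≃ Fin r`
and units `vⱼ` (each `z'ⱼ` is a prime dividing `∏ zᵢ`, hence associated to some `zᵢ`, injectively
by pairwise non-association; symmetrically). [folklore] -/
theorem exists_equiv_units_of_isRsopPart {r r' : ℕ} {z : Fin r → A} {z' : Fin r' → A}
    (hz : IsRsopPart z) (hz' : IsRsopPart z')
    (h : Ideal.span {∏ i, z i} = Ideal.span {∏ j, z' j}) :
    ∃ (e : Fin r' ≃ Fin r) (v : Fin r' → Aˣ), ∀ j, z' j = (v j : A) * z (e j) := by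
  haveI := hz.isRegularLocalRing
  haveI := isDomain_of_isRegularLocalRing A
  have hassoc : Associated (∏ i, z i) (∏ j, z' j) := Ideal.span_singleton_eq_span_singleton.mp h
  -- each `z'ⱼ` is associated to some `z_{τ j}`, and conversely
  have hτ : ∀ j, ∃ i, Associated (z' j) (z i) := fun j =>
    hz.exists_associated_of_prime_dvd_prod (hz'.prime j)
      (hassoc.symm.dvd_iff_dvd_right.mp (Finset.dvd_prod_of_mem _ (Finset.mem_univ j)))
  have hτ' : ∀ i, ∃ j, Associated (z i) (z' j) := fun i =>
    hz'.exists_associated_of_prime_dvd_prod (hz.prime i)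
      (hassoc.dvd_iff_dvd_right.mp (Finset.dvd_prod_of_mem _ (Finset.mem_univ i)))
  choose τ hτ using hτ
  choose τ' hτ' using hτ'
  have hinj : Function.Injective τ := fun j j' hjj' => by
    by_contra hne
    exact hz'.not_associated hne ((hτ j).trans (hjj' ▸ (hτ j').symm))
  have hinj' : Function.Injective τ' := fun i i' hii' => by
    by_contra hne
    exact hz.not_associated hne ((hτ' i).trans (hii' ▸ (hτ' i').symm))
  have hcard : r' = r := le_antisymm (by simpa using Fintype.card_le_of_injective τ hinj)
    (by simpa using Fintype.card_le_of_injective τ' hinj')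
  have hbij : Function.Bijective τ :=
    (Fintype.bijective_iff_injective_and_card τ).mpr ⟨hinj, by simp [hcard]⟩
  have hτu : ∀ j, ∃ w : Aˣ, z' j * w = z (τ j) := fun j => hτ j
  choose w hw using hτu
  refine ⟨Equiv.ofBijective τ hbij, fun j => (w j)⁻¹, fun j => ?_⟩
  rw [Equiv.ofBijective_apply, mul_comm, Units.eq_mul_inv_iff_mul_eq, hw]

variable {K : Type v} [Field K] [Algebra A K] {p : ℕ} {f : K}

/-- **Kato-cleanliness at the closed point does not depend on the local equations of the divisor
germ**: for two parts `z, z'` of regular systems of parameters cutting out the same divisor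
`(∏ zᵢ) = (∏ z'ⱼ)`, `IsCleanAt p z' f ↔ IsCleanAt p z f`. [cite: Kato1994Ramification, (3.4.3)] -/
theorem isCleanAt_iff_of_isRsopPart {r r' : ℕ} {z : Fin r → A} {z' : Fin r' → A}
    (hz : IsRsopPart z) (hz' : IsRsopPart z')
    (h : Ideal.span {∏ i, z i} = Ideal.span {∏ j, z' j}) : IsCleanAt p z' f ↔ IsCleanAt p z f := by
  obtain ⟨e, v, hv⟩ := exists_equiv_units_of_isRsopPart hz hz' h
  have hcard : r' = r := by simpa using Fintype.card_congr e
  subst hcard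
  have hz'eq : z' = unitScale v (z ∘ e) := funext hv
  rw [hz'eq, isCleanAt_unitScale_iff, isCleanAt_reindex_iff]

end Matching

/-! ## The scheme-level statement -/

section Scheme

open _root_.AlgebraicGeometry _root_.CategoryTheory _root_.TopologicalSpace
open _root_.AlgebraicGeometry.Scheme.IdealSheafData

variable {X : Scheme.{u}} [IsIntegral X] {p : ℕ} {D : Set X} {f : X.functionField} {x : X}

/-- **Kato-cleanliness at a point of a strict normal crossings divisor is independent of the local
snc coordinates**: for `D` a strict normal crossings divisor and `x ∈ D`, the Artin–Schreier class
of `f ∈ K(X)` is Kato-clean at `x` (some system of local snc coordinates at `x` in which `IsCleanAt`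
holds) iff `IsCleanAt` holds in EVERY system of local snc coordinates at `x`.
[cite: Kato1994Ramification, (3.4.3)] -/
theorem Scheme.isKatoCleanAt_iff_forall (hD : IsStrictNormalCrossingsDivisor X D) (hx : x ∈ D) :
    Scheme.IsKatoCleanAt X p D f x ↔
      ∀ (r e : ℕ) (z : Fin r → X.presheaf.stalk x) (y : Fin e → X.presheaf.stalk x),
        1 ≤ r → ringKrullDim (X.presheaf.stalk x) = (r + e : ℕ) →
        Ideal.span (Set.range z ∪ Set.range y) = maximalIdeal (X.presheaf.stalk x) →
        (∀ (U : X.affineOpens) (hU : x ∈ (U : X.Opens)),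
          ((vanishingIdeal ⟨closure D, isClosed_closure⟩).ideal U).map
            (X.presheaf.germ U x hU).hom = Ideal.span {∏ i, z i}) →
        IsCleanAt (K := X.functionField) p z f := by
  have hreg := hD.isRegularLocalRing hx
  -- an affine open neighbourhood of `x`, to compare the two local equations of `D`
  obtain ⟨W, hW, hxW, -⟩ := exists_isAffineOpen_mem_and_subset (U := ⊤) (x := x) trivial
  constructor
  · intro h r e z y h1 hdim hspan hcut
    obtain ⟨r₀, e₀, z₀, y₀, -, hdim₀, hspan₀, hcut₀, hclean₀⟩ := h.resolve_left (not_not.mpr hx)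
    have hz₀ : IsRsopPart z₀ := ⟨hreg, e₀, y₀, hdim₀, hspan₀⟩
    have hz : IsRsopPart z := ⟨hreg, e, y, hdim, hspan⟩
    have hspan_eq : Ideal.span {∏ i, z₀ i} = Ideal.span {∏ i, z i} := by
      rw [← hcut₀ ⟨W, hW⟩ hxW, ← hcut ⟨W, hW⟩ hxW]
    exact (isCleanAt_iff_of_isRsopPart hz₀ hz hspan_eq).mpr hclean₀
  · intro h
    obtain ⟨r, e, z, y, h1, hdim, hspan, hcut⟩ := hD.exists_regularSystemOfParameters hx
    exact Or.inr ⟨r, e, z, y, h1, hdim, hspan, hcut, h r e z y h1 hdim hspan hcut⟩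

end Scheme

end Literature.AlgebraicGeometry.Ramification

end
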